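import Mathlib
import HarnessLib
import Summits.NavierStokesRegularity.NavierStokesRegularity.Theorems.TaylorModelRungThreeCertificateBoxField
import Summits.NavierStokesRegularity.NavierStokesRegularity.Theorems.TaylorModelRungThreeReadoutJets
import Summits.NavierStokesRegularity.NavierStokesRegularity.Theorems.TaylorModelRungThreeCertificateIntervalDJetsArray

/-!
# Crux K1b-DR (stmt-NavierStokesRegularity-23954), line `taylor-model` — the truncated cascade field over INTERVAL BOXES
# (`qBboxD`, `QbBoxD`, `QbBoxA`) and the interval Taylor jets of the cascade flow (S1-VECTOR-23954 §3 (B); dss_58 (A)/(B))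

`…CertificateBoxField` (p612205) bounds the truncated field in MAGNITUDE over coordinate boxes (`qBndK`). The v3 checker needs the
SIGNED interval evaluation in the rounded-dyadic arithmetic of `…CertificateIntervalD*`: at a window target `(i, k)`,
`qBboxD T coefB prec U W i k = Σ_{(a,b,μ): both factors on the window} coefB(a,b,i,μ,k) · U(idx a k₁) · W(idx b k₂)` (rounded products
and sums), where `coefB` is ANY table of coefficient boxes sound for the real coefficients (`CoefBoxOK φ T coefB`:
`φ (coefAt a b i μ k) ∈ coefB a b i μ k` on the window — e.g. `ofQS2 prec ∘ coefAt` at `K = ℚ(√2)` by `mem_ofQS2`, or an array of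
pre-rounded boxes read in O(1)); `QbBoxD` is the polarisation `(qB(U,W) + qB(W,U))/2` and `QbBoxA T coefB prec : Array IntervalD →
Array IntervalD → Array IntervalD` its array form over the coordinates `c < n` (decoded by `wi/wk`). Soundness: `mem_qB_boxD`
(`T.wv u c ∈ U c`, `T.wv w c ∈ W c` below `n` ⇒ `qB d u w i k ∈ qBboxD …`), `mem_Qb_boxD`, and the packaged
`isFieldEnclosureA_QbBoxA : IsFieldEnclosureA T.wv d.Qb T.n (T.QbBoxA coefB prec)` — the ONE hypothesis of
`IntervalD.mem_jet_of_jetLevelsA`; whence `mem_taylorJet_of_jetLevelsA`: for every shell state `y` with window coordinates in the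
box `Y`, every Taylor jet `taylorJet d.Qb y k` (`k ≤ K`) has its window coordinates in the materialised interval jets
`jetLevelsA T.n (T.QbBoxA coefB prec) prec Y K` — the `J`/`hJ` supplier of the vector step ((E2)/(R1) of VECTOR-LEMMAS-23954 §2).

MODEL-lattice bookkeeping only (rung TL-M3); nothing here concerns the Navier–Stokes equations.
-/

-- the sub-problem namespace repeats the summit name by design (D-0017)
set_option linter.dupNamespace false

namespace Summit.NavierStokesRegularity.NavierStokesRegularity.Theorems.TaylorModelCert

open scoped BigOperators
open Literature.Analysis.FluidPDE.TaoCascade Literature.Analysis.FluidPDE.TaoCascade.TaylorChain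
open Summit.NavierStokesRegularity.NavierStokesRegularity.Theorems.TaylorModelReadout (trunc trunc_apply qB Qb_eq taylorJet
  taylorJet_zero taylorJet_succ)

namespace CertTables

section Defs

variable {K : Type} [Field K] [LinearOrder K]

/-- **Interval evaluation of the truncated bilinear field over two coordinate boxes** at the window target `(i, k)`: the rounded
sum over the monomials with BOTH factors on the window of `coefB · U(factor 1) · W(factor 2)`. [folklore] -/
def qBboxD (T : CertTables K) (coefB : Fin 4 → Fin 4 → Fin 4 → ℕ → ℤ → IntervalD) (prec : ℕ) (U W : ℕ → IntervalD)
    (i : Fin 4) (k : ℤ) : IntervalD :=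
  IntervalD.rangeSumR prec (fun a => IntervalD.rangeSumR prec (fun b => IntervalD.rangeSumR prec (fun μi =>
    if (-T.Kb ≤ fShell₁ μi k ∧ fShell₁ μi k ≤ T.Ka) ∧ (-T.Kb ≤ fShell₂ μi k ∧ fShell₂ μi k ≤ T.Ka) then
      IntervalD.mulR prec (IntervalD.mulR prec (coefB ⟨a % 4, Nat.mod_lt _ (by omega)⟩ ⟨b % 4, Nat.mod_lt _ (by omega)⟩ i μi k)
        (U (T.idx ⟨a % 4, Nat.mod_lt _ (by omega)⟩ (fShell₁ μi k))))
        (W (T.idx ⟨b % 4, Nat.mod_lt _ (by omega)⟩ (fShell₂ μi k)))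
    else IntervalD.ofInt 0) 4) 4) 4

/-- Interval evaluation of the symmetrised field `Qb = (qB(u,w) + qB(w,u)) / 2` over two coordinate boxes. [folklore] -/
def QbBoxD (T : CertTables K) (coefB : Fin 4 → Fin 4 → Fin 4 → ℕ → ℤ → IntervalD) (prec : ℕ) (U W : ℕ → IntervalD)
    (i : Fin 4) (k : ℤ) : IntervalD :=
  IntervalD.divNat prec (IntervalD.addR prec (T.qBboxD coefB prec U W i k) (T.qBboxD coefB prec W U i k)) 2

/-- The array form of `QbBoxD` over the window coordinates `c < n` (decoded by `wi`, `wk`): the interval twin of the field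
that the materialised interval jets `IntervalD.jetLevelsA` iterate. [folklore] -/
def QbBoxA (T : CertTables K) (coefB : Fin 4 → Fin 4 → Fin 4 → ℕ → ℤ → IntervalD) (prec : ℕ)
    (A B : Array IntervalD) : Array IntervalD :=
  Array.ofFn fun c : Fin T.n => T.QbBoxD coefB prec (IntervalD.aget A) (IntervalD.aget B) (T.wi c) (T.wk c)

/-- The coefficient boxes are SOUND for the real coefficients of the field on the window. [folklore] -/
def CoefBoxOK (φ : K →+* ℝ) (T : CertTables K) (coefB : Fin 4 → Fin 4 → Fin 4 → ℕ → ℤ → IntervalD) : Prop :=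
  ∀ (a b i : Fin 4) (μi : ℕ) (k : ℤ), μi < 4 → -T.Kb ≤ k → k ≤ T.Ka → IntervalD.mem (φ (T.coefAt a b i μi k)) (coefB a b i μi k)

end Defs

/-- At `K = ℚ(√2)` the rounded enclosures `ofQS2 prec (coefAt …)` are sound coefficient boxes. [folklore] -/
theorem coefBoxOK_ofQS2 (T : CertTables QS2) (prec : ℕ) :
    CoefBoxOK QS2.toRealHom T (fun a b i μi k => IntervalD.ofQS2 prec (T.coefAt a b i μi k)) :=
  fun _ _ _ _ _ _ _ _ => IntervalD.mem_ofQS2 prec _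

section Sound

variable {K : Type} [Field K] {φ : K →+* ℝ} (T : CertTables K)
  {coefB : Fin 4 → Fin 4 → Fin 4 → ℕ → ℤ → IntervalD}

/-- **`qB` over interval boxes**: `T.wv u c ∈ U c`, `T.wv w c ∈ W c` on the window coordinates ⇒
`qB d u w i k ∈ qBboxD coefB prec U W i k` at every window target (under `CoefOK`, `CoefBoxOK`). [folklore] -/
theorem mem_qB_boxD (hco : T.CoefOK φ) (hcB : CoefBoxOK φ T coefB) {u w : Fin 4 → ℤ → ℝ} {U W : ℕ → IntervalD}
    (hu : ∀ c < T.n, IntervalD.mem (T.wv u c) (U c)) (hw : ∀ c < T.n, IntervalD.mem (T.wv w c) (W c))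
    (i : Fin 4) {k : ℤ} (hk : -T.Kb ≤ k ∧ k ≤ T.Ka) (prec : ℕ) :
    IntervalD.mem (qB (T.toCertData φ) u w i k) (T.qBboxD coefB prec U W i k) := by
  set d := T.toCertData φ with hd
  have hKb : d.Kb = T.Kb := rfl
  have hKa : d.Ka = T.Ka := rfl
  have hu' : ∀ (a' : Fin 4) {k' : ℤ}, (-T.Kb ≤ k' ∧ k' ≤ T.Ka) → IntervalD.mem (u a' k') (U (T.idx a' k')) := by
    intro a' k' hk'
    have h := hu (T.idx a' k') (T.idx_lt_n a' hk')
    rwa [T.wv_idx u a' hk'] at h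
  have hw' : ∀ (a' : Fin 4) {k' : ℤ}, (-T.Kb ≤ k' ∧ k' ≤ T.Ka) → IntervalD.mem (w a' k') (W (T.idx a' k')) := by
    intro a' k' hk'
    have h := hw (T.idx a' k') (T.idx_lt_n a' hk')
    rwa [T.wv_idx w a' hk'] at h
  unfold qB qBboxD
  rw [hKb, hKa, if_pos hk]
  simp only [sum_fin4_eq, sum_shiftSet_eq]
  refine IntervalD.mem_rangeSumR prec 4 fun a _ => IntervalD.mem_rangeSumR prec 4 fun b _ =>
    IntervalD.mem_rangeSumR prec 4 fun μi hμ => ?_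
  set a' : Fin 4 := ⟨a % 4, Nat.mod_lt _ (by omega)⟩
  set b' : Fin 4 := ⟨b % 4, Nat.mod_lt _ (by omega)⟩
  have hs1 : k - (shifts.getD μi (0, 0, 0)).2.2 + (shifts.getD μi (0, 0, 0)).1 = fShell₁ μi k := rfl
  have hs2 : k - (shifts.getD μi (0, 0, 0)).2.2 + (shifts.getD μi (0, 0, 0)).2.1 = fShell₂ μi k := rfl
  simp only [trunc_apply]
  rw [hs1, hs2, hKb, hKa]
  have hcoef : d.α a' b' i (shifts.getD μi (0, 0, 0)) * (1 + 1 : ℝ) ^ ((5 : ℝ) * (k - (shifts.getD μi (0, 0, 0)).2.2) / 2) =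
      φ (T.coefAt a' b' i μi k) := by
    rw [hco a' b' i μi k hμ hk.1 hk.2, hd, toCertData_α, shifts_getD μi hμ, if_pos hμ, one_add_one_eq_two]
  by_cases hboth : (-T.Kb ≤ fShell₁ μi k ∧ fShell₁ μi k ≤ T.Ka) ∧ (-T.Kb ≤ fShell₂ μi k ∧ fShell₂ μi k ≤ T.Ka)
  · rw [if_pos hboth, if_pos hboth.1, if_pos hboth.2, hcoef, ← mul_assoc]
    exact IntervalD.mem_mulR prec (IntervalD.mem_mulR prec (hcB a' b' i μi k hμ hk.1 hk.2) (hu' a' hboth.1)) (hw' b' hboth.2)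
  · rw [if_neg hboth]
    have hzero : (if -T.Kb ≤ fShell₁ μi k ∧ fShell₁ μi k ≤ T.Ka then u a' (fShell₁ μi k) else 0) *
        (if -T.Kb ≤ fShell₂ μi k ∧ fShell₂ μi k ≤ T.Ka then w b' (fShell₂ μi k) else 0) = 0 := by
      rcases not_and_or.1 hboth with h1 | h2
      · rw [if_neg h1, zero_mul]
      · rw [if_neg h2, mul_zero]
    rw [hzero, mul_zero]
    exact IntervalD.mem_zero

/-- **`Qb` over interval boxes** (polarisation): `d.Qb u w i k ∈ QbBoxD coefB prec U W i k`. [folklore] -/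
theorem mem_Qb_boxD (hco : T.CoefOK φ) (hcB : CoefBoxOK φ T coefB) {u w : Fin 4 → ℤ → ℝ} {U W : ℕ → IntervalD}
    (hu : ∀ c < T.n, IntervalD.mem (T.wv u c) (U c)) (hw : ∀ c < T.n, IntervalD.mem (T.wv w c) (W c))
    (i : Fin 4) {k : ℤ} (hk : -T.Kb ≤ k ∧ k ≤ T.Ka) (prec : ℕ) :
    IntervalD.mem ((T.toCertData φ).Qb u w i k) (T.QbBoxD coefB prec U W i k) := by
  have h1 := T.mem_qB_boxD hco hcB hu hw i hk prec
  have h2 := T.mem_qB_boxD hco hcB hw hu i hk prec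
  have h := IntervalD.mem_divNat prec (IntervalD.mem_addR prec h1 h2) (n := 2) two_pos
  rw [Qb_eq]
  unfold QbBoxD
  simpa using h

/-- **The array form is an interval extension of the field** (the hypothesis of `IntervalD.mem_jet_of_jetLevelsA`), the
states being read through the window coordinates `T.wv`. [folklore] -/
theorem isFieldEnclosureA_QbBoxA (hco : T.CoefOK φ) (hcB : CoefBoxOK φ T coefB) (prec : ℕ) :
    IntervalD.IsFieldEnclosureA T.wv (T.toCertData φ).Qb T.n (T.QbBoxA coefB prec) := by
  intro A B u w _ _ hu hw c hc
  unfold QbBoxA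
  rw [IntervalD.aget_ofFn _ hc]
  exact T.mem_Qb_boxD hco hcB hu hw (T.wi c) (T.InW_wk hc) prec

/-- **Interval Taylor jets of the truncated cascade flow**: if the window coordinates of a shell state `y` lie in the box `Y`
(`Y.size = n`), then for every order `k ≤ K` and window coordinate `c < n` the jet coordinate `T.wv (taylorJet d.Qb y k) c`
lies in `(jetLevelsA n (QbBoxA coefB prec) prec Y K)[k][c]`. [folklore] -/
theorem mem_taylorJet_of_jetLevelsA (hco : T.CoefOK φ) (hcB : CoefBoxOK φ T coefB) (prec K : ℕ) {Y : Array IntervalD}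
    (hY : Y.size = T.n) {y : Fin 4 → ℤ → ℝ} (hy : ∀ c < T.n, IntervalD.mem (T.wv y c) (IntervalD.aget Y c)) :
    ∀ k ≤ K, ∀ c < T.n, IntervalD.mem (T.wv (taylorJet (T.toCertData φ).Qb y k) c)
      (IntervalD.aget (IntervalD.lget (IntervalD.jetLevelsA T.n (T.QbBoxA coefB prec) prec Y K) k) c) := by
  refine IntervalD.mem_jet_of_jetLevelsA (T := taylorJet (T.toCertData φ).Qb) (fun x c _ => by rw [taylorJet_zero])
    (fun x k c _ => ?_) (T.isFieldEnclosureA_QbBoxA hco hcB prec) prec K hY hy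
  have h := congrFun (congrFun (taylorJet_succ (T.toCertData φ).Qb x k) (T.wi c)) (T.wk c)
  simp only [Pi.smul_apply, smul_eq_mul, Finset.sum_apply] at h
  simpa only [wv] using h

end Sound

end CertTables

end Summit.NavierStokesRegularity.NavierStokesRegularity.Theorems.TaylorModelCert
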